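import Mathlib
import HarnessLib
import Literature.MathematicalPhysics.StatisticalMechanics.TaylorPolynomialNorms
import Literature.MathematicalPhysics.StatisticalMechanics.TaylorPolynomialNormsExpectation
import Literature.MathematicalPhysics.QuantumFieldTheory.TphiSeminorm
import Literature.MathematicalPhysics.QuantumFieldTheory.TphiSeminormTaylor

/-!
# Norms on Taylor polynomials relative to a gauge — IV. Change of gauge and the two-norm estimate
# (Adams–Buchholz–Kotecký–Müller, Proposition 13.11 and Lemma 8.1 (8.3))

Two gauges `T₁ : E →ₗ V₁`, `T₂ : E →ₗ V₂` on the same space of fields which are comparable,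
`‖T₁ ξ‖ ≤ ρ ‖T₂ ξ‖` for all `ξ` (for the lattice gauges of consecutive scales, `|ξ|_{k,X} ≤ ρ |ξ|_{k+1,X}`
with `ρ = 2 L^{-d/2}`, [ABKM19] proof of Lemma 8.1: "`|g^{(r)}|_{k,X} ≤ 2^r L^{-r d/2} |g^{(r)}|_{k+1,X}`"),
give rise to the TWO-NORM ESTIMATE ([ABKM19] Proposition 13.11, specialised in Lemma 8.1 (8.3)):

`|F|_{k+1,X,T_φ} ≤ (1 + |φ|_{k+1,X})^{m+1} ( |F|_{k+1,X,T_0} + 2ρ^{m+1} sup_ψ |F|_{k,X,T_ψ} )`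

([ABKM19] (8.3) is the case `m = 2`, `2ρ³ = 16 L^{-3d/2}`).  With the bridge
`tayNorm T r₀ F φ = tphiSeminorm r₀ 1 (gaugeLift T F) (Tφ)` (file III) this is the tree's
Bauerschmidt–Brydges–Slade Corollary 7.5.4 (`tphiSeminorm_le_of_tzero_tsup`, two values `𝔥 ≤ h` of
the field unit) on the gauge space `range T₂`, once the gauge-`T₁` norm is identified with a LARGER
field unit on `range T₂`:

* `norm_iteratedFDeriv_gaugeLift_le_of_factor` — termwise pull-back bound
  `‖D^s F̄(Tφ)‖ ≤ ‖D^s f(Pφ)‖ c^s` for `F = f ∘ P`, `‖Pξ‖ ≤ c‖Tξ‖`;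
* `tphiSeminorm_gaugeLift_le_of_factor`, **`tphiSeminorm_gaugeLift_mono_gauge`** —
  `‖F̄₂‖_{T_{T₂φ}(𝔥)} ≤ ‖F̄₁‖_{T_{T₁φ}(𝔥ρ)}`: a gauge smaller by the factor `ρ` is a field unit larger by
  `1/ρ` ([ABKM19] (13.23), the quantity `ρ^{(r)}`);
* **`tayNorm_two_gauge_le`** — the two-norm estimate above ([ABKM19] Prop. 13.11 / (8.3));
* **`tayNorm_le_tayNorm_zero_mul_pow`** — the POLYNOMIAL PROPERTY ([ABKM19] Prop. 13.10,
  [BBS19] Exercise 7.5.2): `‖F‖_{T_φ} ≤ ‖F‖_{T_0}(1 + ‖Tφ‖)^k` for `F` polynomial of degree `≤ k`.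

Everything is proved; no named fact.

## References
* S. Adams, S. Buchholz, R. Kotecký, S. Müller, arXiv:1910.13564, Proposition 13.11, Lemma 8.1 (8.3)
  [AdamsBuchholzKoteckyMuller2019].
* R. Bauerschmidt, D. Brydges, G. Slade, LNM 2242 (2019), Corollary 7.5.4 [BauerschmidtBrydgesSlade2019RG].
-/

noncomputable section

namespace Literature.MathematicalPhysics.StatisticalMechanics.GradientRG

open Finset
open Literature.MathematicalPhysics.QuantumFieldTheory

variable {E V : Type*} [NormedAddCommGroup E] [NormedSpace ℝ E] [FiniteDimensional ℝ E]
  [NormedAddCommGroup V] [NormedSpace ℝ V]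
  {𝔸 : Type*} [NormedRing 𝔸] [NormedAlgebra ℝ 𝔸]

/-- **Termwise pull-back bound**: if `F = f ∘ P` with `P : E →ₗ U` linear, `‖P ξ‖ ≤ c‖T ξ‖` (`c ≥ 0`)
and `f ∈ C^{r₀}`, then `‖D^s F̄ (Tφ)‖ ≤ ‖D^s f (Pφ)‖ · c^s` for `s ≤ r₀` (`F̄ = gaugeLift T F`).
[cite: AdamsBuchholzKoteckyMuller2019, Lemma 13.4 (ii)] -/
theorem norm_iteratedFDeriv_gaugeLift_le_of_factor {U : Type*} [NormedAddCommGroup U]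
    [NormedSpace ℝ U] (T : E →ₗ[ℝ] V) (P : E →ₗ[ℝ] U) {c : ℝ} (hc : 0 ≤ c)
    (hP : ∀ ξ, ‖P ξ‖ ≤ c * ‖T ξ‖) {r₀ : ℕ} {f : U → 𝔸} (hf : ContDiff ℝ r₀ f) {F : E → 𝔸}
    (hF : ∀ φ, F φ = f (P φ)) (φ : E) {s : ℕ} (hs : s ≤ r₀) :
    ‖iteratedFDeriv ℝ s (gaugeLift T F) (T.rangeRestrict φ)‖ ≤
      ‖iteratedFDeriv ℝ s f (P φ)‖ * c ^ s := by
  let Q : LinearMap.range T →L[ℝ] U :=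
    LinearMap.toContinuousLinearMap (P ∘ₗ gaugeSection T)
  have hQapply : ∀ w : LinearMap.range T, Q w = P (gaugeSection T w) := fun w => rfl
  have hQnorm : ‖Q‖ ≤ c := by
    refine ContinuousLinearMap.opNorm_le_bound _ hc fun w => ?_
    rw [hQapply]
    refine (hP _).trans ?_
    rw [apply_gaugeSection]
    rfl
  have hlift : gaugeLift T F = f ∘ Q := by
    funext w
    rw [gaugeLift_apply, hF, Function.comp_apply, hQapply]
  have hQφ : Q (T.rangeRestrict φ) = P φ := by
    rw [hQapply, ← sub_eq_zero, ← map_sub]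
    have h0 := hP (gaugeSection T (T.rangeRestrict φ) - φ)
    rw [map_sub T, apply_gaugeSection, show ((T.rangeRestrict φ : LinearMap.range T) : V) = T φ
      from rfl, sub_self, norm_zero, mul_zero] at h0
    exact norm_le_zero_iff.1 h0
  have hs' : (s : WithTop ℕ∞) ≤ r₀ := by exact_mod_cast hs
  rw [hlift, Q.iteratedFDeriv_comp_right hf _ hs', hQφ]
  refine (ContinuousMultilinearMap.norm_compContinuousLinearMap_le _ _).trans ?_
  refine mul_le_mul_of_nonneg_left ?_ (norm_nonneg _)
  rw [Finset.prod_const, Finset.card_univ, Fintype.card_fin]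
  exact pow_le_pow_left₀ (norm_nonneg _) hQnorm s

/-- The pull-back bound with a field unit `𝔥`: `‖F̄‖_{T_{Tφ}(𝔥)} ≤ ‖f‖_{T_{Pφ}(𝔥c)}` for `F = f ∘ P`,
`‖Pξ‖ ≤ c‖Tξ‖`. [cite: AdamsBuchholzKoteckyMuller2019, Lemma 13.4 (ii)] -/
theorem tphiSeminorm_gaugeLift_le_of_factor {U : Type*} [NormedAddCommGroup U] [NormedSpace ℝ U]
    (T : E →ₗ[ℝ] V) (P : E →ₗ[ℝ] U) {c : ℝ} (hc : 0 ≤ c) (hP : ∀ ξ, ‖P ξ‖ ≤ c * ‖T ξ‖)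
    {r₀ : ℕ} {f : U → 𝔸} (hf : ContDiff ℝ r₀ f) {F : E → 𝔸} (hF : ∀ φ, F φ = f (P φ))
    {𝔥 : ℝ} (h𝔥 : 0 ≤ 𝔥) (φ : E) :
    tphiSeminorm r₀ 𝔥 (gaugeLift T F) (T.rangeRestrict φ) ≤ tphiSeminorm r₀ (𝔥 * c) f (P φ) := by
  unfold tphiSeminorm
  refine Finset.sum_le_sum fun s hs => ?_
  have hs' : s ≤ r₀ := Nat.lt_succ_iff.1 (Finset.mem_range.1 hs)
  have h := norm_iteratedFDeriv_gaugeLift_le_of_factor T P hc hP hf hF φ hs'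
  have hfac : (0 : ℝ) < s.factorial := by positivity
  calc 𝔥 ^ s / (s.factorial : ℝ) * ‖iteratedFDeriv ℝ s (gaugeLift T F) (T.rangeRestrict φ)‖
      ≤ 𝔥 ^ s / (s.factorial : ℝ) * (‖iteratedFDeriv ℝ s f (P φ)‖ * c ^ s) :=
        mul_le_mul_of_nonneg_left h (div_nonneg (pow_nonneg h𝔥 _) hfac.le)
    _ = (𝔥 * c) ^ s / (s.factorial : ℝ) * ‖iteratedFDeriv ℝ s f (P φ)‖ := by
        rw [mul_pow]; ring

/-- **Change of gauge = change of field unit** ([ABKM19] (13.23)): if `‖T₁ ξ‖ ≤ ρ ‖T₂ ξ‖` for all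
`ξ` (`ρ ≥ 0`) and `F` is `T₁`-local and `C^{r₀}`, then for every field unit `𝔥 ≥ 0`
`‖F̄₂‖_{T_{T₂φ}(𝔥)} ≤ ‖F̄₁‖_{T_{T₁φ}(𝔥ρ)}` (`F̄ᵢ = gaugeLift Tᵢ F`): measured with the LARGER gauge
`T₂` the function looks like the `T₁`-measurement at the larger field unit `𝔥ρ`… i.e. SMALLER for
`ρ < 1` in the high Taylor orders. [cite: AdamsBuchholzKoteckyMuller2019, Proposition 13.11 (the quantity ρ, (13.23))] -/
theorem tphiSeminorm_gaugeLift_mono_gauge {V₁ : Type*} [NormedAddCommGroup V₁] [NormedSpace ℝ V₁]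
    (T₁ : E →ₗ[ℝ] V₁) (T₂ : E →ₗ[ℝ] V) {ρ : ℝ} (hρ : 0 ≤ ρ) (h : ∀ ξ, ‖T₁ ξ‖ ≤ ρ * ‖T₂ ξ‖)
    {r₀ : ℕ} {F : E → 𝔸} (hF : ContDiff ℝ r₀ F) (hloc : IsGaugeLocal T₁ F) {𝔥 : ℝ} (h𝔥 : 0 ≤ 𝔥)
    (φ : E) :
    tphiSeminorm r₀ 𝔥 (gaugeLift T₂ F) (T₂.rangeRestrict φ) ≤
      tphiSeminorm r₀ (𝔥 * ρ) (gaugeLift T₁ F) (T₁.rangeRestrict φ) :=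
  tphiSeminorm_gaugeLift_le_of_factor T₂ T₁.rangeRestrict hρ h (contDiff_gaugeLift T₁ hF)
    (fun ψ => (gaugeLift_rangeRestrict hloc ψ).symm) h𝔥 φ

/-- **The two-norm estimate in gauge form** ([ABKM19] Proposition 13.11; Lemma 8.1 (8.3) is the
case `m = 2`, `ρ = 2L^{-d/2}`): let `‖T₁ ξ‖ ≤ ρ ‖T₂ ξ‖` for all `ξ` with `0 < ρ ≤ 1`, let `F` be
`T₁`-local and `C^{r₀}` with values in a complete normed algebra, `m < r₀`, and suppose
`sup_ψ ‖F‖^{(T₁)}_{T_ψ} ≤ F_∞`.  Then for every `φ`,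
`‖F‖^{(T₂)}_{T_φ} ≤ (1 + ‖T₂ φ‖)^{m+1} ( ‖F‖^{(T₂)}_{T_0} + 2 ρ^{m+1} F_∞ )`.
[cite: AdamsBuchholzKoteckyMuller2019, Proposition 13.11] -/
theorem tayNorm_two_gauge_le [CompleteSpace 𝔸] {V₁ : Type*} [NormedAddCommGroup V₁]
    [NormedSpace ℝ V₁] (T₁ : E →ₗ[ℝ] V₁) (T₂ : E →ₗ[ℝ] V) {ρ : ℝ} (hρ0 : 0 < ρ) (hρ1 : ρ ≤ 1)
    (h : ∀ ξ, ‖T₁ ξ‖ ≤ ρ * ‖T₂ ξ‖) {r₀ m : ℕ} (hm : m < r₀) {F : E → 𝔸} (hF : ContDiff ℝ r₀ F)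
    (hloc : IsGaugeLocal T₁ F) {Fsup : ℝ} (hFsup : ∀ ψ : E, tayNorm T₁ r₀ F ψ ≤ Fsup) (φ : E) :
    tayNorm T₂ r₀ F φ ≤
      (1 + ‖T₂ φ‖) ^ (m + 1) * (tayNorm T₂ r₀ F 0 + 2 * ρ ^ (m + 1) * Fsup) := by
  -- on the gauge space `range T₂`, with field units `1 ≤ 1/ρ`
  have hsup : ∀ w : LinearMap.range T₂, tphiSeminorm r₀ ρ⁻¹ (gaugeLift T₂ F) w ≤ Fsup := by
    intro w
    -- every `w` is `T₂ ψ` for `ψ = gaugeSection T₂ w`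
    have hw : T₂.rangeRestrict (gaugeSection T₂ w) = w := rangeRestrict_gaugeSection T₂ w
    rw [← hw]
    refine (tphiSeminorm_gaugeLift_mono_gauge T₁ T₂ hρ0.le h hF hloc (inv_nonneg.2 hρ0.le) _).trans ?_
    rw [inv_mul_cancel₀ hρ0.ne', ← tayNorm_eq_tphiSeminorm]
    exact hFsup _
  have key := tphiSeminorm_le_of_tzero_tsup r₀ hm one_pos (one_le_inv_iff₀.2 ⟨hρ0, hρ1⟩)
    (contDiff_gaugeLift T₂ hF) hsup (T₂.rangeRestrict φ)
  rw [tayNorm_eq_tphiSeminorm, tayNorm_eq_tphiSeminorm, map_zero]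
  rw [div_one, one_div, inv_inv] at key
  exact key

/-- **Polynomial property** ([ABKM19] Proposition 13.10 = [BBS19] Exercise 7.5.2): if `F` is
`C^{r₀}` with values in a complete normed algebra and a POLYNOMIAL of degree `≤ k` in the
field (`D^{k+1} F ≡ 0`, `k < r₀`), then `‖F‖_{T_φ} ≤ ‖F‖_{T_0} · (1 + ‖T φ‖)^k` — e.g. relevant
Hamiltonians (`k = 2`). [cite: AdamsBuchholzKoteckyMuller2019, Proposition 13.10] -/
theorem tayNorm_le_tayNorm_zero_mul_pow [CompleteSpace 𝔸] (T : E →ₗ[ℝ] V) {r₀ k : ℕ} (hk : k < r₀)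
    {F : E → 𝔸} (hF : ContDiff ℝ r₀ F) (hD : ∀ ψ : E, iteratedFDeriv ℝ (k + 1) F ψ = 0) (φ : E) :
    tayNorm T r₀ F φ ≤ tayNorm T r₀ F 0 * (1 + ‖T φ‖) ^ k := by
  -- the lift is a polynomial of degree `≤ k` on `range T`: its `(k+1)`-st derivative vanishes
  have hk' : ((k + 1 : ℕ) : WithTop ℕ∞) ≤ r₀ := by exact_mod_cast hk
  have hDlift : ∀ w : LinearMap.range T, iteratedFDeriv ℝ (k + 1) (gaugeLift T F) w = 0 := by
    intro w
    have h := (gaugeSectionCLM T).iteratedFDeriv_comp_right hF w hk'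
    -- `gaugeLift T F = F ∘ gaugeSectionCLM T`
    have hcomp : gaugeLift T F = F ∘ (gaugeSectionCLM T) := rfl
    rw [hcomp, h, hD]
    ext v
    simp [ContinuousMultilinearMap.compContinuousLinearMap_apply]
  have key := tphiSeminorm_le_tzero_mul_pow_of_iteratedFDeriv_eq_zero r₀ one_pos hk
    (contDiff_gaugeLift T hF) hDlift (T.rangeRestrict φ)
  rw [tayNorm_eq_tphiSeminorm, tayNorm_eq_tphiSeminorm, map_zero]
  rw [div_one] at key
  exact key

end Literature.MathematicalPhysics.StatisticalMechanics.GradientRG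

end
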